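import Summits.SmoothPoincare4.SmoothPoincare4.Theorems.WeakReductionDescentDependentTripleGenusThreeStandardSurgeryInversionAux1
import Literature.Topology.FourManifolds.LevelPassageSurgery
import HarnessLib

/-!
# Crux `WeakReductionDescent.DependentTripleGenusThreeStandard` (stmt-SmoothPoincare4-18000), line
# `Sketch` — surgery inversion II: the two gluing maps of the inverse surgery and their common part

Second auxiliary file of the registered helper `helper_isCircleSurgery_of_isSurgery_sphereTwo`
(`--supports stmt-SmoothPoincare4-18000`: a sphere surgery of type `(3, 2)` in a 4-manifold is
undone by a circle surgery — Aranda–Zupan 2025, Prop. 5.5; Gompf–Stipsicz 1999, §5.2).  Let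
`ν : S² × ℝ² ↪ M⁴` be one framed 2-sphere (`FramedSphereFamily (𝓡 4) M Unit 2 2`) and let
`jA : M ∖ ν(S² × 0) → X′`, `jB : Unit × OD³ × S¹ → X′` be gluing maps of a surgery along it
(`sphereFamilySurgeryRel ν`: `ν(v, θ u) ∼ (θ v, u)`, `0 < θ < 1`).  With the squeeze
`σ(y) = y/√(1 + ‖y‖²)` of the first file:

* `SurgeryInversion.exists_gluingMapB` — `(w, v) ↦ ν(v, σ w)` is a smooth embedding `OD² × S² ↪ M`
  with open range (the disc piece `discTimesSphere` of the circle surgery re-embedded in `M`);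
* `SurgeryInversion.rel_tube` — the basic identity of the two gluings: Milnor's relation holds
  between `ν(v, σ(t u)) ∈ M ∖ ν(S² × 0)` and `(⋆, σ(t v), u) ∈ Unit × OD³ × S¹` at the common radial
  parameter `θ = t/√(1 + t²)`;
* `SurgeryInversion.jA_ne_core`, `SurgeryInversion.mem_range_of_forall_ne` and the registered
  lemma `helper_mem_range_iff_of_sphereSurgeryGluing` — `jA(M ∖ ν(S² × 0))` is exactly the
  complement of the core `jB(⋆, 0, S¹)` of the new piece;
* `SurgeryInversion.exists_gluingMapA` — on an open `U ⊆ jA(M ∖ ν(S² × 0))`, `jA⁻¹` followed by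
  the inclusion into `M` is a smooth embedding with open range (the tree's
  `contMDiffOn_symm_of_isSmoothEmbedding` and `isSmoothEmbedding_comp_subtypeVal_of_subset_source`).

Everything here is proved; no definition, no named fact.

References: R. Gompf, A. Stipsicz, *4-Manifolds and Kirby Calculus*, GSM 20 (1999), §5.2;
J. Milnor, *Lectures on the h-cobordism theorem* (1965), Def. 3.11 (PDF p. 17).
-/

-- the registered namespace `Summit.SmoothPoincare4.SmoothPoincare4.Theorems…` repeats a component
set_option linter.dupNamespace false

noncomputable section

open scoped Manifold ContDiff Topology
open Set Function Metric Topology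
open Literature.Topology.FourManifolds

namespace Summit.SmoothPoincare4.SmoothPoincare4.Theorems

namespace SurgeryInversion

/-! ### The disc piece `OD² × S² → M`, `(w, v) ↦ ν(v, σ w)` -/

section DiscPiece

variable {M : Type*} [TopologicalSpace M] [ChartedSpace (EuclideanSpace ℝ (Fin 4)) M]
  [IsManifold (𝓡 4) ∞ M] (ν : FramedSphereFamily (𝓡 4) M Unit 2 2)

/-- **The second gluing map of the inverse surgery**: `(w, v) ↦ ν(v, w/√(1 + ‖w‖²))` is a smooth
embedding `OD² × S² ↪ M` with open range (swap, squeeze and apply the framed sphere: the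
restriction to the open disc piece of a globally defined partial diffeomorphism `ℝ² × S² ⇀ M`,
`isSmoothEmbedding_comp_subtypeVal_of_subset_source`). [cite: GompfStipsicz1999, §5.2] -/
theorem exists_gluingMapB :
    ∃ kB : ↥discTimesSphere → M,
      Manifold.IsSmoothEmbedding (𝓘(ℝ, EuclideanSpace ℝ (Fin 2)).prod (𝓡 2)) (𝓡 4) ∞ kB ∧
      IsOpen (range kB) ∧
      ∀ b, kB b = ν.toFun ()
        ((b : EuclideanSpace ℝ (Fin 2) × (Metric.sphere (0 : EuclideanSpace ℝ (Fin 3)) 1)).2,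
          OpenPartialHomeomorph.univUnitBall
            (b : EuclideanSpace ℝ (Fin 2) × (Metric.sphere (0 : EuclideanSpace ℝ (Fin 3)) 1)).1) := by
  have hν : IsOpenEmbedding (ν.toFun ()) :=
    ⟨(ν.isSmoothEmbedding ()).isEmbedding, ν.isOpen_range ()⟩
  set v₀ : Metric.sphere (0 : EuclideanSpace ℝ (Fin 3)) 1 := ⟨EuclideanSpace.single 0 1, by simp⟩
  haveI : Nonempty ((Metric.sphere (0 : EuclideanSpace ℝ (Fin 3)) 1) × EuclideanSpace ℝ (Fin 2)) :=
    ⟨(v₀, 0)⟩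
  haveI : Nonempty ↥discTimesSphere := ⟨⟨((0 : EuclideanSpace ℝ (Fin 2)), v₀), by simp⟩⟩
  -- the reparametrisation `ℝ² × S² ⇀ S² × OD²`, `(w, v) ↦ (v, σ w)`
  set ψ : OpenPartialHomeomorph (EuclideanSpace ℝ (Fin 2) × (Metric.sphere (0 : EuclideanSpace ℝ (Fin 3)) 1))
      ((Metric.sphere (0 : EuclideanSpace ℝ (Fin 3)) 1) × EuclideanSpace ℝ (Fin 2)) :=
    (Homeomorph.prodComm (EuclideanSpace ℝ (Fin 2)) (Metric.sphere (0 : EuclideanSpace ℝ (Fin 3)) 1)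
        ).toOpenPartialHomeomorph.trans
      ((OpenPartialHomeomorph.refl (Metric.sphere (0 : EuclideanSpace ℝ (Fin 3)) 1)).prod
        OpenPartialHomeomorph.univUnitBall) with hψ
  have hψf : (ψ : _ → _) = fun p => (p.2, OpenPartialHomeomorph.univUnitBall p.1) := rfl
  have hψf' : (ψ.symm : _ → _) = fun q => (OpenPartialHomeomorph.univUnitBall.symm q.2, q.1) := rfl
  have hψs : ψ.source = univ := by
    rw [hψ, OpenPartialHomeomorph.trans_source, OpenPartialHomeomorph.prod_source,
      OpenPartialHomeomorph.refl_source, OpenPartialHomeomorph.univUnitBall_source, univ_prod_univ,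
      preimage_univ, inter_univ]
    rfl
  have hψt : ψ.target = univ ×ˢ ball (0 : EuclideanSpace ℝ (Fin 2)) 1 := by
    rw [hψ, OpenPartialHomeomorph.trans_target, OpenPartialHomeomorph.prod_target,
      OpenPartialHomeomorph.refl_target, OpenPartialHomeomorph.univUnitBall_target]
    ext p
    simp only [mem_inter_iff, mem_prod, mem_univ, true_and, mem_preimage,
      OpenPartialHomeomorph.prod_symm, OpenPartialHomeomorph.refl_symm,
      OpenPartialHomeomorph.prod_apply, OpenPartialHomeomorph.refl_apply, id_eq]
    exact ⟨fun h => h.1, fun h => ⟨h, mem_univ _⟩⟩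
  -- the partial diffeomorphism `ℝ² × S² ⇀ M`
  set Φ := ψ.trans (hν.toOpenPartialHomeomorph (ν.toFun ())) with hΦ
  have hΦf : (Φ : _ → M) = fun p => ν.toFun () (p.2, OpenPartialHomeomorph.univUnitBall p.1) := rfl
  have hΦs : Φ.source = univ := by
    rw [hΦ, OpenPartialHomeomorph.trans_source, hψs]
    simp
  have h1 : ContMDiffOn (𝓘(ℝ, EuclideanSpace ℝ (Fin 2)).prod (𝓡 2)) (𝓡 4) ∞ Φ Φ.source := by
    rw [hΦf]
    exact ((ν.contMDiff ()).comp (contMDiff_snd.prodMk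
      (OpenPartialHomeomorph.contDiff_univUnitBall.contMDiff.comp contMDiff_fst))).contMDiffOn
  have h2 : ContMDiffOn (𝓡 4) (𝓘(ℝ, EuclideanSpace ℝ (Fin 2)).prod (𝓡 2)) ∞ Φ.symm Φ.target := by
    rw [hΦ, OpenPartialHomeomorph.trans_target]
    have hψ2 : ContMDiffOn ((𝓡 2).prod 𝓘(ℝ, EuclideanSpace ℝ (Fin 2)))
        (𝓘(ℝ, EuclideanSpace ℝ (Fin 2)).prod (𝓡 2)) ∞ ψ.symm ψ.target := by
      rw [hψt, hψf']
      have hs : ContMDiffOn 𝓘(ℝ, EuclideanSpace ℝ (Fin 2)) 𝓘(ℝ, EuclideanSpace ℝ (Fin 2)) ∞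
          OpenPartialHomeomorph.univUnitBall.symm (ball (0 : EuclideanSpace ℝ (Fin 2)) 1) :=
        OpenPartialHomeomorph.contDiffOn_univUnitBall_symm.contMDiffOn
      exact (hs.comp contMDiffOn_snd fun p hp => hp.2).prodMk contMDiffOn_fst
    refine hψ2.comp ((contMDiffOn_symm_of_isSmoothEmbedding (ν.isSmoothEmbedding ()) hν).mono ?_)
      fun m hm => hm.2
    intro m hm
    simpa using hm.1
  have hsub : ((discTimesSphere : TopologicalSpace.Opens _) : Set _) ⊆ Φ.source := by
    rw [hΦs]; exact subset_univ _
  obtain ⟨hk, hkr⟩ := isSmoothEmbedding_comp_subtypeVal_of_subset_source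
    (I := 𝓘(ℝ, EuclideanSpace ℝ (Fin 2)).prod (𝓡 2)) (J := 𝓡 4) Φ h1 h2
    (ContinuousLinearEquiv.ofFinrankEq (by simp [Module.finrank_prod])) discTimesSphere hsub
  refine ⟨Φ ∘ Subtype.val, hk, ?_, fun b => rfl⟩
  rw [hkr]
  exact Φ.isOpen_image_of_subset_source discTimesSphere.isOpen hsub

end DiscPiece

/-! ### The common part `jA(M ∖ ν(S² × 0)) = X′ ∖ ℓ(S¹)` of the two gluings -/

section Common

variable {M : Type*} [TopologicalSpace M] [T2Space M] [ChartedSpace (EuclideanSpace ℝ (Fin 4)) M]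
  (ν : FramedSphereFamily (𝓡 4) M Unit 2 2)

/-- Off the zero section the squeezed tube point `ν(v, σ(t u))`, `t > 0`, lies in the complement
of the core sphere. [folklore] -/
theorem tube_mem_complement (v : Metric.sphere (0 : EuclideanSpace ℝ (Fin 3)) 1)
    (u : Metric.sphere (0 : EuclideanSpace ℝ (Fin 2)) 1) {t : ℝ} (ht : 0 < t) :
    ν.toFun () (v, OpenPartialHomeomorph.univUnitBall (t • (u : EuclideanSpace ℝ (Fin 2)))) ∈
      ν.complement := by
  refine ν.apply_mem_complement () v ?_
  rw [Ne, univUnitBall_eq_zero_iff, smul_eq_zero, not_or]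
  exact ⟨ht.ne', ne_zero_of_mem_unit_sphere u⟩

/-- **The basic identity of the two gluings**: Milnor's relation holds between the tube point
`ν(v, σ(t u))` of `M ∖ ν(S² × 0)` and the point `(⋆, σ(t v), u)` of the new piece, at the common
radial parameter `θ = t/√(1 + t²)`. [cite: MilnorHCobordism1965, Def. 3.11 (PDF p. 17)] -/
theorem rel_tube (v : Metric.sphere (0 : EuclideanSpace ℝ (Fin 3)) 1)
    (u : Metric.sphere (0 : EuclideanSpace ℝ (Fin 2)) 1) {t : ℝ} (ht : 0 < t) :
    sphereFamilySurgeryRel ν ⟨_, tube_mem_complement ν v u ht⟩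
      ⟨(DiscreteIndex.mk (), OpenPartialHomeomorph.univUnitBall (t • (v : EuclideanSpace ℝ (Fin 3))), u),
        norm_univUnitBall_lt _⟩ := by
  refine ⟨v, t * (Real.sqrt (1 + t ^ 2))⁻¹, profile_mem_Ioo ht,
    univUnitBall_smul (norm_eq_of_mem_sphere v) ht.le, ?_⟩
  show ν.toFun () (v, OpenPartialHomeomorph.univUnitBall (t • (u : EuclideanSpace ℝ (Fin 2)))) =
    ν.toFun () (v, (t * (Real.sqrt (1 + t ^ 2))⁻¹) • (u : EuclideanSpace ℝ (Fin 2)))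
  rw [univUnitBall_smul (norm_eq_of_mem_sphere u) ht.le]

/-- The complement of the core sphere is nonempty. [folklore] -/
theorem nonempty_complement : Nonempty ↥ν.complement :=
  ⟨⟨_, tube_mem_complement ν ⟨EuclideanSpace.single 0 1, by simp⟩ ⟨EuclideanSpace.single 0 1, by simp⟩
    one_pos⟩⟩

variable {X' : Type*} {jA : ↥ν.complement → X'} {jB : ↥(ballTimesSphere Unit 2 1) → X'}

/-- No point of `jA(M ∖ ν(S² × 0))` lies on the core `jB(⋆, 0, ·)` of the new piece: the relation
would force `0 = θ v` with `θ > 0`, `‖v‖ = 1`. [folklore] -/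
theorem jA_ne_core (hR : ∀ a b, jA a = jB b ↔ sphereFamilySurgeryRel ν a b) (a : ↥ν.complement)
    (b : ↥(ballTimesSphere Unit 2 1))
    (hb : (b : DiscreteIndex Unit ×
      (EuclideanSpace ℝ (Fin 3) × (Metric.sphere (0 : EuclideanSpace ℝ (Fin 2)) 1))).2.1 = 0) :
    jA a ≠ jB b := by
  intro h
  obtain ⟨v, θ, hθ, h0, -⟩ := (hR a b).1 h
  rw [hb] at h0
  rcases smul_eq_zero.1 h0.symm with h1 | h1
  · exact hθ.1.ne' h1
  · exact ne_zero_of_mem_unit_sphere v h1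

/-- **`X′ ∖ jB(⋆, 0, S¹) ⊆ jA(M ∖ ν(S² × 0))`**: a point of the new piece off its core,
`jB(⋆, y, u)` with `y ≠ 0`, is the image `jA(ν(y/‖y‖, ‖y‖ u))`. [cite: MilnorHCobordism1965, Def. 3.11 (PDF p. 17)] -/
theorem mem_range_of_forall_ne (hU : range jA ∪ range jB = univ)
    (hR : ∀ a b, jA a = jB b ↔ sphereFamilySurgeryRel ν a b) {x : X'}
    (hx : ∀ b : ↥(ballTimesSphere Unit 2 1), (b : DiscreteIndex Unit ×
      (EuclideanSpace ℝ (Fin 3) × (Metric.sphere (0 : EuclideanSpace ℝ (Fin 2)) 1))).2.1 = 0 → jB b ≠ x) :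
    x ∈ range jA := by
  rcases eq_univ_iff_forall.1 hU x with hxA | ⟨b, rfl⟩
  · exact hxA
  · obtain ⟨⟨i, y, u⟩, hb⟩ := b
    have hy : y ≠ 0 := fun hy => hx _ hy rfl
    have hy0 : 0 < ‖y‖ := norm_pos_iff.2 hy
    have hy1 : ‖y‖ < 1 := hb
    set v : Metric.sphere (0 : EuclideanSpace ℝ (Fin 3)) 1 := ⟨‖y‖⁻¹ • y, by
      rw [mem_sphere_zero_iff_norm, norm_smul, norm_inv, norm_norm, inv_mul_cancel₀ hy0.ne']⟩ with hv
    have hyv : y = ‖y‖ • (v : EuclideanSpace ℝ (Fin 3)) := by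
      rw [hv]; dsimp only; rw [smul_smul, mul_inv_cancel₀ hy0.ne', one_smul]
    refine ⟨⟨ν.toFun () (v, ‖y‖ • (u : EuclideanSpace ℝ (Fin 2))),
      ν.apply_mem_complement () v (smul_ne_zero hy0.ne' (ne_zero_of_mem_unit_sphere u))⟩, ?_⟩
    exact (hR _ _).2 ⟨v, ‖y‖, ⟨hy0, hy1⟩, hyv, rfl⟩

/-! ### The first gluing map `jA⁻¹ : X′ ∖ ℓ(S¹) → M` -/

variable [TopologicalSpace X'] [ChartedSpace (EuclideanSpace ℝ (Fin 4)) X'] [IsManifold (𝓡 4) ∞ X']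
  [IsManifold (𝓡 4) ∞ M]

/-- **The first gluing map of the inverse surgery**: on an open `U ⊆ jA(M ∖ ν(S² × 0))` of `X′`,
the inverse of `jA` followed by the inclusion `M ∖ ν(S² × 0) ⊆ M` is a smooth embedding `U ↪ M`
with open range (the inverse of an open smooth embedding is smooth,
`contMDiffOn_symm_of_isSmoothEmbedding`; `isSmoothEmbedding_comp_subtypeVal_of_subset_source`). [folklore] -/
theorem exists_gluingMapA (hAs : Manifold.IsSmoothEmbedding (𝓡 4) (𝓡 4) ∞ jA)
    (hAo : IsOpen (range jA)) (U : TopologicalSpace.Opens X') [Nonempty U]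
    (hU : (U : Set X') ⊆ range jA) :
    ∃ kA : U → M, Manifold.IsSmoothEmbedding (𝓡 4) (𝓡 4) ∞ kA ∧ IsOpen (range kA) ∧
      ∀ (a : ↥ν.complement) (ha : jA a ∈ U), kA ⟨jA a, ha⟩ = a := by
  have hA : IsOpenEmbedding jA := ⟨hAs.isEmbedding, hAo⟩
  haveI := nonempty_complement ν
  set c := ν.complement.openPartialHomeomorphSubtypeCoe (nonempty_complement ν) with hc
  set Φ := (hA.toOpenPartialHomeomorph jA).symm.trans c with hΦ
  have hΦs : Φ.source = range jA := by
    rw [hΦ, OpenPartialHomeomorph.trans_source]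
    simp [hc]
  have h1 : ContMDiffOn (𝓡 4) (𝓡 4) ∞ Φ Φ.source := by
    rw [hΦs]
    exact contMDiff_subtype_val.comp_contMDiffOn (contMDiffOn_symm_of_isSmoothEmbedding hAs hA)
  have h2 : ContMDiffOn (𝓡 4) (𝓡 4) ∞ Φ.symm Φ.target := by
    have key : EqOn (Subtype.val ∘ c.symm) id c.target := fun w hw => c.right_inv hw
    have hcs : ContMDiffOn (𝓡 4) (𝓡 4) ∞ c.symm c.target := by
      intro z hz
      have h1 : ContMDiffWithinAt (𝓡 4) (𝓡 4) ∞ (Subtype.val ∘ c.symm) c.target z :=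
        contMDiffWithinAt_id.congr key (key hz)
      exact (ContMDiffWithinAt.subtypeVal_comp_iff ν.complement _ _ _).1 h1
    have htgt : Φ.target ⊆ c.target := by
      rw [hΦ, OpenPartialHomeomorph.trans_target]
      exact inter_subset_left
    exact (hAs.contMDiff.comp_contMDiffOn hcs).mono htgt
  have hU' : (U : Set X') ⊆ Φ.source := by rwa [hΦs]
  obtain ⟨hk, hkr⟩ := isSmoothEmbedding_comp_subtypeVal_of_subset_source (I := 𝓡 4) (J := 𝓡 4) Φ
    h1 h2 (ContinuousLinearEquiv.refl ℝ _) U hU'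
  refine ⟨Φ ∘ Subtype.val, hk, ?_, fun a ha => ?_⟩
  · rw [hkr]
    exact Φ.isOpen_image_of_subset_source U.isOpen hU'
  · show (((hA.toOpenPartialHomeomorph jA).symm (jA a) : ↥ν.complement) : M) = a
    rw [hA.toOpenPartialHomeomorph_left_inv]

end Common

end SurgeryInversion

/-- **In a sphere-surgery gluing, the image of `M ∖ ν(S² × 0)` is exactly the complement of the
core `jB(⋆, 0, S¹)` of the new piece** (registered lemma of this auxiliary file): if
`jA : M ∖ ν(S² × 0) → X′` and `jB : Unit × OD³ × S¹ → X′` cover `X′` and meet along Milnor's relation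
`ν(v, θ u) ∼ (θ v, u)`, `0 < θ < 1`, then `x ∈ jA(M ∖ ν(S² × 0))` iff `x` is not of the form
`jB(⋆, 0, u)` — a point `jB(⋆, y, u)` with `y ≠ 0` being `jA(ν(y/‖y‖, ‖y‖ u))`, while `jA a = jB(⋆, 0, u)`
would force `0 = θ v`. [cite: MilnorHCobordism1965, Def. 3.11 (PDF p. 17)] -/
theorem helper_mem_range_iff_of_sphereSurgeryGluing :
    ∀ (M : Type) [TopologicalSpace M] [T2Space M] [ChartedSpace (EuclideanSpace ℝ (Fin 4)) M] (ν : FramedSphereFamily (𝓡 4) M Unit 2 2) (X' : Type) (jA : ↥ν.complement → X') (jB : ↥(ballTimesSphere Unit 2 1) → X'), Set.range jA ∪ Set.range jB = Set.univ → (∀ a b, jA a = jB b ↔ sphereFamilySurgeryRel ν a b) → ∀ x : X', x ∈ Set.range jA ↔ ∀ b : ↥(ballTimesSphere Unit 2 1), (b : DiscreteIndex Unit × (EuclideanSpace ℝ (Fin 3) × Metric.sphere (0 : EuclideanSpace ℝ (Fin 2)) 1)).2.1 = 0 → jB b ≠ x := by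
  intro M _ _ _ ν X' jA jB hU hR x
  refine ⟨?_, SurgeryInversion.mem_range_of_forall_ne ν hU hR⟩
  rintro ⟨a, rfl⟩ b hb h
  exact SurgeryInversion.jA_ne_core ν hR a b hb h.symm

end Summit.SmoothPoincare4.SmoothPoincare4.Theorems

end
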